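import Literature.GroupTheory.CombinatorialGroupTheory.PuncturedBoundarySystem
import Literature.GroupTheory.CombinatorialGroupTheory.PuncturedSurfaceGroupCuspBases
import Literature.GroupTheory.CombinatorialGroupTheory.PuncturedSurfaceGroupClosedCase
import HarnessLib

/-!
# Finite-index subgroups of punctured surface groups: assembly from the Schreier layer and the
# boundary normal form (GT-A, BRICK 3)

Topic `Literature/GroupTheory/CombinatorialGroupTheory`.  The named fact
`PuncturedSurfaceGroupFiniteIndexSubgroup` (Hoare–Karrass–Solitar, Math. Z. 120 (1971) Thm 1;
Zieschang–Vogt–Coldewey, LNM 835, Thm 4.14.1 / §4.14: a finite-index subgroup `K` of `Γ_{g,r}` is a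
`Γ_{g',r'}` with `2g' + r' - 2 = [Γ:K](2g + r - 2)` AND the induced peripheral structure — cusps of `K`
= double cosets `K\Γ/⟨c_j⟩`) is here reduced to the two layers of the cell's GT-A plan, taken as
VERBATIM hypotheses (no new `Prop` definitions):

* `hS` = the SCHREIER layer (`ShapeS`, seat abc-iut-w5-d186): for a one-vertex downstairs face system
  `S` over the free alphabet `X` and `K ≤ F(X)` of finite index, the boundary system `Fs` of the
  covering ribbon graph (one vertex, over the non-tree edges `E`, `|E| + [F:K] = [F:K]|X| + 1`) with
  `Φ : F(E) ≅ K` carrying each face to `rep · (face word)^m · rep⁻¹`, `m` the ramification (the exact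
  generator of `K ∩ rep⟨face word⟩rep⁻¹`), the faces over a downstairs face `f` being in bijection
  with the double cosets `K δ ⟨mk f⟩`;
* `hN` = the NORMAL-FORM layer (`ShapeN`, seat abc-iut-w5-d160): a one-vertex face system `Fs` over
  `E` is the peripheral system of a punctured surface group: `Λ : Γ_{g',|Fs|} ≅ F(E)`,
  `2g' + |Fs| = |E| + 1`, `Λ(c_j)` conjugate to the `j`-th face word (up to a permutation `σ`).

With the downstairs boundary system `baseSystem g r r` of `S_{g,r+1}` in the free basis of `Γ_{g,r+1}`
(`PuncturedBoundarySystem.lean`: face `0` reads `A·B = A·(e c₁)⁻¹·A⁻¹`, the petals read `(e c_{j+2})⁻¹`)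
and the free basis `e` of `exists_mulEquiv_freeGroup_elim_first` (seat abc-iut-w5-d016), the
homomorphism `θ := e⁻¹ ∘ Φ ∘ Λ : Γ_{g',r'} → Γ_{g,r+1}` is injective with range `K`, the counts give
Riemann–Hurwitz `2g' + r' + 2d = d(2g + r + 1) + 2`, `θ(c_{j'}) = γ · c_j^{-m} · γ⁻¹` gives the cusp
clause `θ⟨c_{j'}⟩ = K ∩ γ⟨c_j⟩γ⁻¹` (the `m ∣ n` clause), and the double-coset bijection transports to
the `∃!` clause (`puncturedSurfaceGroupFiniteIndexSubgroup_of_shapes`); the closed case `r = 0` is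
`finiteIndexSubgroup_zero` (`PuncturedSurfaceGroupClosedCase.lean`).  Theorems only.

## References

* A. H. M. Hoare, A. Karrass, D. Solitar, *Subgroups of finite index of Fuchsian groups*, Math. Z.
  120 (1971), Thm 1; H. Zieschang, E. Vogt, H.-D. Coldewey, *Surfaces and Planar Discontinuous
  Groups*, LNM 835, Springer 1980, Thm 4.14.1, §4.14. [ZieschangVogtColdewey1980]
-/

namespace Literature.GroupTheory.CombinatorialGroupTheory.PuncturedSurfaceGroup

open List Equiv Equiv.Perm Function Subgroup

/-! ### The free basis on the cusps -/

/-- Conjugation by an inverse commutes with powers. [cite: ZieschangVogtColdewey1980, 3.1.1] -/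
theorem conj_zpow_inv {G : Type*} [Group G] (a b : G) (t : ℤ) : (a⁻¹ * b * a) ^ t = a⁻¹ * b ^ t * a := by
  have h := @conj_zpow G _ t a⁻¹ b
  rwa [inv_inv] at h

/-- Under a free basis `e : Γ_{g,r+1} ≅ F(X)` with `aᵢ, bᵢ ↦ aᵢ, bᵢ` and `c_{j+2} ↦ inr j`, the first
cusp goes to `A⁻¹B⁻¹` (the relator `A c₁ B = 1`), i.e. `e (c_j) = cuspElt j` for every cusp.
[cite: ZieschangVogtColdewey1980, 3.1.8] -/
theorem mulEquiv_c_eq_cuspElt {g r : ℕ} (e : PuncturedSurfaceGroup g (r + 1) ≃* FreeGroup ((Fin g × Bool) ⊕ Fin r))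
    (hea : ∀ i, e (a i) = FreeGroup.of (Sum.inl (i, false)))
    (heb : ∀ i, e (b i) = FreeGroup.of (Sum.inl (i, true)))
    (hec : ∀ j : Fin r, e (c (Fin.succ j)) = FreeGroup.of (Sum.inr j)) (j : Fin (r + 1)) :
    e (c j) = cuspElt g r j := by
  refine Fin.cases ?_ (fun j' => ?_) j
  · -- the relator, pushed through `e`
    have h1 : (PresentedGroup.mk ({relator g (r + 1)} : Set (FreeGroup (puncturedSurfaceGen g (r + 1)))))
        ((((List.finRange g).map fun i =>
            genA (r := r + 1) i * genB (r := r + 1) i * (genA (r := r + 1) i)⁻¹ * (genB (r := r + 1) i)⁻¹).prod) *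
          (genC (g := g) 0 * ((List.finRange r).map fun j => genC (g := g) (Fin.succ j)).prod)) = 1 := by
      rw [← relator_succ]
      exact (PresentedGroup.mk_eq_one_iff).2 (subset_normalClosure (Set.mem_singleton _))
    rw [map_mul, map_mul] at h1
    have h2 := congrArg e h1
    rw [map_mul, map_mul, map_one] at h2
    have hA : e (PresentedGroup.mk ({relator g (r + 1)} : Set (FreeGroup (puncturedSurfaceGen g (r + 1))))
        (((List.finRange g).map fun i =>
          genA (r := r + 1) i * genB (r := r + 1) i * (genA (r := r + 1) i)⁻¹ * (genB (r := r + 1) i)⁻¹).prod)) =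
        handleProd g r := by
      simp only [handleProd, map_list_prod, List.map_map, Function.comp_def, map_mul, map_inv]
      congr 1
      refine List.map_congr_left fun i _ => ?_
      rw [show (PresentedGroup.mk ({relator g (r + 1)} : Set _)) (genA (r := r + 1) i) = a i from rfl,
        show (PresentedGroup.mk ({relator g (r + 1)} : Set _)) (genB (r := r + 1) i) = b i from rfl, hea, heb]
    have hB : e (PresentedGroup.mk ({relator g (r + 1)} : Set (FreeGroup (puncturedSurfaceGen g (r + 1))))
        (((List.finRange r).map fun j => genC (g := g) (Fin.succ j)).prod)) = petalProd g r := by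
      simp only [petalProd, map_list_prod, List.map_map, Function.comp_def]
      congr 1
      refine List.map_congr_left fun j _ => ?_
      rw [show (PresentedGroup.mk ({relator g (r + 1)} : Set _)) (genC (g := g) (Fin.succ j)) = c (Fin.succ j)
        from rfl, hec]
    rw [hA, hB, show (PresentedGroup.mk ({relator g (r + 1)} : Set _)) (genC (g := g) 0) =
      (c 0 : PuncturedSurfaceGroup g (r + 1)) from rfl] at h2
    rw [cuspElt, Fin.cases_zero]
    -- `A * (e c₀ * B) = 1`
    have : e (c 0) = (handleProd g r)⁻¹ * (petalProd g r)⁻¹ := by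
      have h3 : handleProd g r * e (c 0) = (petalProd g r)⁻¹ :=
        eq_inv_of_mul_eq_one_left (by rw [mul_assoc]; exact h2)
      rw [← h3]; group
    exact this
  · rw [hec, cuspElt, Fin.cases_succ]

/-! ### The assembly -/

/-- **GT-A assembled from the Schreier layer and the boundary normal form**
(Hoare–Karrass–Solitar 1971 Thm 1 / ZVC Thm 4.14.1): if `hS` (the covering ribbon graph of a
finite-index subgroup of a free group with respect to a one-vertex downstairs face system, with its
cusp dictionary) and `hN` (a one-vertex face system is the peripheral system of a punctured surface
group) hold, then every finite-index subgroup of a hyperbolic `Γ_{g,r}` is a punctured surface group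
`Γ_{g',r'}`, `2g' + r' + 2d = d(2g + r) + 2`, with the induced peripheral structure — the named fact
`PuncturedSurfaceGroupFiniteIndexSubgroup`. [cite: ZieschangVogtColdewey1980, Thm 4.14.1 p.150] -/
theorem puncturedSurfaceGroupFiniteIndexSubgroup_of_shapes
    (hS : ∀ {X : Type} [Fintype X] [DecidableEq X]
      (S : List (List (X × Bool))), S.flatten.Nodup → (∀ x, x ∈ S.flatten) → (∀ F ∈ S, F ≠ []) →
      (∀ x y, (sysPerm S).SameCycle x y) →
      ∀ (K : Subgroup (FreeGroup X)), K.FiniteIndex →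
      ∃ (E : Type) (_ : Fintype E) (_ : DecidableEq E) (Φ : FreeGroup E ≃* K)
        (Fs : List (List (E × Bool)))
        (face : Fin Fs.length → Fin S.length) (rep : Fin Fs.length → FreeGroup X)
        (m : Fin Fs.length → ℕ),
        Fs.flatten.Nodup ∧ (∀ l, l ∈ Fs.flatten) ∧ (∀ W ∈ Fs, W ≠ []) ∧
        (∀ l l', (sysPerm Fs).SameCycle l l') ∧
        Fintype.card E + K.index = K.index * Fintype.card X + 1 ∧
        (∀ i, 0 < m i ∧
          ((Φ (FreeGroup.mk (Fs.get i)) : FreeGroup X) =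
            rep i * FreeGroup.mk (S.get (face i)) ^ (m i) * (rep i)⁻¹) ∧
          (∀ n : ℤ, rep i * FreeGroup.mk (S.get (face i)) ^ n * (rep i)⁻¹ ∈ K ↔ (m i : ℤ) ∣ n)) ∧
        (∀ (f : Fin S.length) (δ : FreeGroup X), ∃! i : Fin Fs.length, face i = f ∧
          ∃ k ∈ K, ∃ z ∈ Subgroup.zpowers (FreeGroup.mk (S.get f)), rep i = k * δ * z))
    (hN : ∀ {E : Type} [Fintype E] [DecidableEq E]
      (Fs : List (List (E × Bool))), Fs ≠ [] → Fs.flatten.Nodup → (∀ l, l ∈ Fs.flatten) →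
      (∀ W ∈ Fs, W ≠ []) → (∀ l l', (sysPerm Fs).SameCycle l l') →
      ∃ (g' : ℕ) (Λ : PuncturedSurfaceGroup g' Fs.length ≃* FreeGroup E)
        (σ : Fin Fs.length ≃ Fin Fs.length),
        2 * g' + Fs.length = Fintype.card E + 1 ∧
        ∀ j : Fin Fs.length, ∃ h : FreeGroup E,
          Λ (PuncturedSurfaceGroup.c j) = h * FreeGroup.mk (Fs.get (σ j)) * h⁻¹) :
    Literature.GroupTheory.CombinatorialGroupTheory.PuncturedSurfaceGroupFiniteIndexSubgroup := by
  intro g r hgr K hK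
  cases r with
  | zero => exact finiteIndexSubgroup_zero g hgr K
  | succ r =>
  classical
  -- the free basis and the downstairs boundary system
  obtain ⟨e, hea, heb, hec⟩ := exists_mulEquiv_freeGroup_elim_first g r
  have hce : ∀ j : Fin (r + 1), e (c j) = cuspElt g r j := mulEquiv_c_eq_cuspElt e hea heb hec
  have hX : Fintype.card ((Fin g × Bool) ⊕ Fin r) = 2 * g + r := by
    simp only [Fintype.card_sum, Fintype.card_prod, Fintype.card_fin, Fintype.card_bool]; ring
  have h2 : 0 < g ∨ 0 < r := by unfold IsHyperbolicType at hgr; omega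
  have hgr2 : 2 ≤ 2 * g + r := by unfold IsHyperbolicType at hgr; omega
  let K₁ : Subgroup (FreeGroup ((Fin g × Bool) ⊕ Fin r)) := K.map e.toMonoidHom
  have hidx : K₁.index = K.index := index_map_equiv K e
  haveI : K₁.FiniteIndex := ⟨by rw [hidx]; exact hK.index_ne_zero⟩
  have hK₁ : ∀ x : FreeGroup ((Fin g × Bool) ⊕ Fin r), x ∈ K₁ ↔ e.symm x ∈ K := fun x => mem_map_equiv
  set S₀ := baseSystem g r r with hS₀
  have hlenS₀ : S₀.length = r + 1 := length_baseSystem le_rfl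
  -- (S) the covering boundary system of `K`
  obtain ⟨E, instF, instD, Φ, Fs, face, rep, m, hdFs, hallFs, hneFs, hVFs, hcard, hper, huniq⟩ :=
    hS S₀ (nodup_baseSystem r) mem_baseSystem (fun F hF => ne_nil_of_mem_baseSystem h2 hF)
      (fun x y => sameCycle_sysPerm_baseSystem le_rfl x (mem_baseSystem x) y (mem_baseSystem y)) K₁ inferInstance
  letI := instF
  letI := instD
  rw [hidx, hX] at hcard
  -- `Fs` is not empty
  set N := K.index * (2 * g + r) with hNdef
  have hNd : 2 * K.index ≤ N := by
    rw [hNdef, mul_comm 2 K.index]; exact Nat.mul_le_mul_left _ hgr2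
  have hd1 : 1 ≤ K.index := Nat.one_le_iff_ne_zero.2 hK.index_ne_zero
  have hFs : Fs ≠ [] := by
    intro hFs0
    have hE : Fintype.card E = 0 := Fintype.card_eq_zero_iff.2 ⟨fun x => by
      have := hallFs (x, true); rw [hFs0] at this; simp at this⟩
    omega
  -- (N) the boundary normal form
  obtain ⟨g', Λ, σ, hcount, hconj⟩ := hN Fs hFs hdFs hallFs hneFs hVFs
  choose hh hhh using hconj
  -- the downstairs cusp dictionary
  choose w hw using mk_baseSystem_get (g := g) (r := r)
  -- the data
  let θ : PuncturedSurfaceGroup g' Fs.length →* PuncturedSurfaceGroup g (r + 1) :=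
    (e.symm.toMonoidHom.comp K₁.subtype).comp (Φ.toMonoidHom.comp Λ.toMonoidHom)
  let cusp : Fin Fs.length → Fin (r + 1) := fun j' => Fin.cast hlenS₀ (face (σ j'))
  let u : Fin Fs.length → FreeGroup ((Fin g × Bool) ⊕ Fin r) := fun j' =>
    (Φ (hh j') : FreeGroup ((Fin g × Bool) ⊕ Fin r)) * rep (σ j') * w (face (σ j'))
  let repΓ : Fin Fs.length → PuncturedSurfaceGroup g (r + 1) := fun j' => e.symm (u j')
  have hθ : ∀ y, θ y = e.symm ((Φ (Λ y) : FreeGroup ((Fin g × Bool) ⊕ Fin r))) := fun y => rfl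
  -- the value of `θ` on a cusp generator
  have hθc : ∀ j' : Fin Fs.length,
      θ (c j') = repΓ j' * (c (cusp j')) ^ (-(m (σ j') : ℤ)) * (repΓ j')⁻¹ := by
    intro j'
    apply e.injective
    rw [map_mul, map_mul, map_inv, map_zpow, hce]
    change e (e.symm ((Φ (Λ (c j')) : FreeGroup ((Fin g × Bool) ⊕ Fin r)))) = e (e.symm (u j')) * _ * (e (e.symm (u j')))⁻¹
    rw [e.apply_symm_apply, e.apply_symm_apply, hhh j', map_mul, map_mul, map_inv, Subgroup.coe_mul,
      Subgroup.coe_mul, Subgroup.coe_inv, (hper (σ j')).2.1, hw (face (σ j')), conj_pow, inv_pow]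
    have hcast : (Fin.cast (length_baseSystem (g := g) (r := r) le_rfl) (face (σ j'))) = cusp j' := rfl
    rw [hcast]
    simp only [u, zpow_neg, zpow_natCast]
    group
  -- `θ` lands in `K`
  have hθK : ∀ y, θ y ∈ K := fun y => by rw [hθ, ← hK₁]; exact (Φ (Λ y)).2
  have hrange : θ.range = K := by
    ext x
    constructor
    · rintro ⟨y, rfl⟩; exact hθK y
    · intro hx
      have hx1 : e x ∈ K₁ := by rw [hK₁, e.symm_apply_apply]; exact hx
      refine ⟨Λ.symm (Φ.symm ⟨e x, hx1⟩), ?_⟩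
      rw [hθ, Λ.apply_symm_apply, Φ.apply_symm_apply]
      exact e.symm_apply_apply x
  refine ⟨g', Fs.length, θ, cusp, repΓ, ?_, ?_, hrange, ?_, fun j' => ?_, fun j γ₀ => ?_⟩
  · -- hyperbolicity of `(g', r')`
    unfold IsHyperbolicType; omega
  · exact (e.symm.injective.comp Subtype.val_injective).comp (Φ.injective.comp Λ.injective)
  · -- Riemann–Hurwitz
    have : K.index * (2 * g + (r + 1)) = N + K.index := by rw [hNdef]; ring
    omega
  · -- the cusps of `K`
    rw [cuspInertia, MonoidHom.map_zpowers, hθc, peripheralSubgroup, cuspInertia, MonoidHom.map_zpowers]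
    set γ := repΓ j'
    set cc := (c (cusp j') : PuncturedSurfaceGroup g (r + 1))
    have hconj : (MulAut.conj γ).toMonoidHom cc = γ * cc * γ⁻¹ := rfl
    rw [hconj, ← conj_zpow]
    apply le_antisymm
    · refine le_inf ?_ ?_
      · rw [zpowers_le, conj_zpow, ← hθc]; exact hθK _
      · exact zpowers_le.2 (zpow_mem (mem_zpowers _) _)
    · rintro x ⟨hxK, hx⟩
      obtain ⟨n, rfl⟩ := mem_zpowers_iff.1 hx
      -- `m ∣ n` from the `m ∣ n` clause of the Schreier layer
      have hdvd : (m (σ j') : ℤ) ∣ n := by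
        have hmem : e ((γ * cc * γ⁻¹) ^ n) ∈ K₁ := by rw [hK₁, e.symm_apply_apply]; exact hxK
        rw [conj_zpow, map_mul, map_mul, map_inv, map_zpow, hce] at hmem
        change e (e.symm (u j')) * _ * (e (e.symm (u j')))⁻¹ ∈ K₁ at hmem
        rw [e.apply_symm_apply] at hmem
        have hΦh : (Φ (hh j') : FreeGroup ((Fin g × Bool) ⊕ Fin r)) ∈ K₁ := (Φ (hh j')).2
        have key : rep (σ j') * FreeGroup.mk (S₀.get (face (σ j'))) ^ (-n) * (rep (σ j'))⁻¹ ∈ K₁ := by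
          rw [hw (face (σ j')), conj_zpow, zpow_neg, inv_zpow, inv_inv]
          have e1 : rep (σ j') * (w (face (σ j')) * cuspElt g r (Fin.cast hlenS₀ (face (σ j'))) ^ n *
              (w (face (σ j')))⁻¹) * (rep (σ j'))⁻¹ =
              (Φ (hh j') : FreeGroup ((Fin g × Bool) ⊕ Fin r))⁻¹ * (u j' * cuspElt g r (cusp j') ^ n * (u j')⁻¹) * (Φ (hh j')) := by
            simp only [u, cusp]; group
          rw [e1]
          exact mul_mem (mul_mem (inv_mem hΦh) hmem) hΦh
        have := ((hper (σ j')).2.2 (-n)).1 key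
        rwa [Int.dvd_neg] at this
      obtain ⟨k, hk⟩ := hdvd
      refine mem_zpowers_iff.2 ⟨-k, ?_⟩
      rw [← zpow_mul, hk]; congr 1; ring
  · -- the double-coset bijection
    set f : Fin S₀.length := Fin.cast hlenS₀.symm j with hf
    have hcuspj : ∀ j', cusp j' = j ↔ face (σ j') = f := fun j' => by
      simp only [cusp, hf, Fin.ext_iff, Fin.val_cast]
    set δ : FreeGroup ((Fin g × Bool) ⊕ Fin r) := e γ₀ * (w f)⁻¹ with hδ
    obtain ⟨i, ⟨hfi, k₁, hk₁, z₁, hz₁, hrep⟩, huni⟩ := huniq f δ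
    have hwf : (w f)⁻¹ * FreeGroup.mk (S₀.get f) * w f = (cuspElt g r j)⁻¹ := by
      rw [hw f]
      have : Fin.cast (length_baseSystem (g := g) (r := r) le_rfl) f = j := Fin.ext (by simp [hf])
      rw [this]; group
    refine ⟨σ.symm i, ⟨?_, ?_⟩, ?_⟩
    · rw [hcuspj, Equiv.apply_symm_apply]; exact hfi
    · -- `rep` of the new cusp is `k γ₀ z`
      obtain ⟨t, rfl⟩ := mem_zpowers_iff.1 hz₁
      refine ⟨e.symm ((Φ (hh (σ.symm i)) : FreeGroup ((Fin g × Bool) ⊕ Fin r)) * k₁), ?_, (c j) ^ (-t), zpow_mem (mem_zpowers _) _, ?_⟩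
      · rw [← hK₁]; exact mul_mem (Φ (hh (σ.symm i))).2 hk₁
      · apply e.injective
        simp only [repΓ, u, map_mul, map_zpow, e.apply_symm_apply, Equiv.apply_symm_apply, hce]
        rw [hrep, hfi, hδ]
        have e2 : FreeGroup.mk (S₀.get f) ^ t * w f = w f * (cuspElt g r j)⁻¹ ^ t := by
          rw [← hwf, conj_zpow_inv]
          group
        calc (Φ (hh (σ.symm i)) : FreeGroup ((Fin g × Bool) ⊕ Fin r)) * (k₁ * (e γ₀ * (w f)⁻¹) * FreeGroup.mk (S₀.get f) ^ t) * w f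
            = (Φ (hh (σ.symm i)) : FreeGroup ((Fin g × Bool) ⊕ Fin r)) * k₁ * e γ₀ * ((w f)⁻¹ * (FreeGroup.mk (S₀.get f) ^ t * w f)) := by
              group
          _ = (Φ (hh (σ.symm i)) : FreeGroup ((Fin g × Bool) ⊕ Fin r)) * k₁ * e γ₀ * (cuspElt g r j) ^ (-t) := by
              rw [e2]; group
    · -- uniqueness
      rintro j'' ⟨hcusp'', k', hk', z', hz', hrep''⟩
      have hface'' : face (σ j'') = f := (hcuspj j'').1 hcusp''
      suffices hσ : σ j'' = i by rw [← hσ, Equiv.symm_apply_apply]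
      refine huni (σ j'') ⟨hface'', ?_⟩
      obtain ⟨t, rfl⟩ := mem_zpowers_iff.1 hz'
      refine ⟨(Φ (hh j'') : FreeGroup ((Fin g × Bool) ⊕ Fin r))⁻¹ * e k', mul_mem (inv_mem (Φ (hh j'')).2) (by rw [hK₁, e.symm_apply_apply]; exact hk'),
        w f * (cuspElt g r j) ^ t * (w f)⁻¹, ?_, ?_⟩
      · have hcu : cuspElt g r j = (w f)⁻¹ * (FreeGroup.mk (S₀.get f))⁻¹ * w f := by
          rw [← inv_inv (cuspElt g r j), ← hwf]; group
        have : w f * cuspElt g r j ^ t * (w f)⁻¹ = FreeGroup.mk (S₀.get f) ^ (-t) := by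
          rw [hcu, conj_zpow_inv]; group
        rw [this]
        exact zpow_mem (mem_zpowers _) _
      · have hu : u j'' = e (repΓ j'') := (e.apply_symm_apply _).symm
        have hu' : (Φ (hh j'') : FreeGroup ((Fin g × Bool) ⊕ Fin r)) * rep (σ j'') * w f = e k' * e γ₀ * (cuspElt g r j) ^ t := by
          rw [← hface'']
          change u j'' = _
          rw [hu, hrep'', map_mul, map_mul, map_zpow, hce]
        calc rep (σ j'') = (Φ (hh j'') : FreeGroup ((Fin g × Bool) ⊕ Fin r))⁻¹ * ((Φ (hh j'') : FreeGroup ((Fin g × Bool) ⊕ Fin r)) * rep (σ j'') * w f) * (w f)⁻¹ := by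
              group
          _ = (Φ (hh j'') : FreeGroup ((Fin g × Bool) ⊕ Fin r))⁻¹ * e k' * (e γ₀ * (w f)⁻¹) * (w f * cuspElt g r j ^ t * (w f)⁻¹) := by
              rw [hu']; group

end Literature.GroupTheory.CombinatorialGroupTheory.PuncturedSurfaceGroup
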